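import Summits.Ventures.CertifiedManyBodySolver.Downfold.EmeryScalingLaw
import Summits.Ventures.CertifiedManyBodySolver.Downfold.EmeryFermiSurfaceShapeBox
import HarnessLib

/-!
# THE SCALING LAW FOR THE SECOND ONE-BAND COORDINATE: the velocity-matched one-band hopping `scaleT` of the σ row is homogeneous of degree ONE —
# at fixed doping `t_eff/t_pd` (or `t_eff/Δ`) is a function of the three ratios `(Δ/t_pd, t_pp/t_pd, t_pp′/t_pd)` only (INFL-3to1-B §B.84 (e))

Venture CertifiedManyBodySolver, cell `pub/hubbard-downfold` (stage S1; INFLATION-RULES-3to1-B §B.84 (e)), seat hubbard-downfold-mod-4 (technique B = band level,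
g35); namespace `Summit.Ventures.CertifiedManyBodySolver.Downfold.Emery`. Everything PROVED (0 sorry, no definition). WHAT THIS IS NOT: a statement about any
material; `U = 0` one-body kinematics of the σ model; no number lives here.

Object E of the cell has two coordinates: the Fermi-surface SHAPE `t′/t = fsRatio` (scale free, `EmeryScalingLaw` §4) and the SCALE `t_eff = scaleT(x, y; ε) =
fsT(ε)/∂_ε charCubic(x, y; ε)` (`EmeryFermiSurfaceShapeBox` §, the velocity-matched one-band hopping at a contour point; §B.64/§B.74). Under
`(Δ, t_pd, t_pp, t_pp′, ε) ↦ λ·(…)` at fixed `(x, y)`: `fsT` is homogeneous of degree 3 and `∂_ε charCubic` of degree 2 (`fsT_smul`, `dcA_smul`, `dfsD_smul`,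
`dfsN_smul`, `dcharCubic_smul`), hence **`scaleT(λθ; x, y; λε) = λ·scaleT(θ; x, y; ε)`** (`scaleT_smul`, `λ ≠ 0`) and, at the scaled row's OWN Fermi energy,
**`scaleT(λθ; x, y; ε_F(λθ; ν)) = λ·scaleT(θ; x, y; ε_F(θ; ν))`** (`scaleT_fermiEnergyOf_smul`; contour points are scale free by `charCubic_smul_eq_zero_iff`, so the
node / face / any Fermi-surface point of the scaled row is the same `(x, y)`). Consequence (value-free): the velocity-matched `t` of a σ row at fixed doping, in
units of `t_pd`, depends on the row only through the three ratios (`scaleT_fermiEnergyOf_div_tpd_eq_ratios`); a common rescaling of a typed row (pressure's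
zeroth-order effect, a unit change) rescales `t_eff` by the same factor and leaves `t′/t` and `t_eff/t_pd` untouched.

Sources: three-band model [HybertsenSchluterChristensen1989, Eq. (1)]; contour variables [AndersenEtAl1995, §6]; [folklore].
-/

noncomputable section

namespace Summit.Ventures.CertifiedManyBodySolver.Downfold.Emery

open Real Set

/-- `fsT` is homogeneous of degree 3. [folklore] -/
theorem fsT_smul (l Δ a b c ε : ℝ) : fsT (l * Δ) (l * a) (l * b) (l * c) (l * ε) = l ^ 3 * fsT Δ a b c ε := by
  unfold fsT; rw [fsD_smul, fsN_smul]; ring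

/-- `dcA` is homogeneous of degree 2. [folklore] -/
theorem dcA_smul (l Δ ε : ℝ) : dcA (l * Δ) (l * ε) = l ^ 2 * dcA Δ ε := by unfold dcA; ring

/-- `dfsD` is homogeneous of degree 2. [folklore] -/
theorem dfsD_smul (l Δ a c ε : ℝ) : dfsD (l * Δ) (l * a) (l * c) (l * ε) = l ^ 2 * dfsD Δ a c ε := by unfold dfsD; ring

/-- `dfsN` is homogeneous of degree 2. [folklore] -/
theorem dfsN_smul (l b c : ℝ) : dfsN (l * b) (l * c) = l ^ 2 * dfsN b c := by unfold dfsN; ring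

/-- **`∂_ε charCubic` is homogeneous of degree 2** at fixed `(x, y)`. [folklore] -/
theorem dcharCubic_smul (l Δ a b c x y ε : ℝ) :
    dcharCubic (l * Δ) (l * a) (l * b) (l * c) x y (l * ε) = l ^ 2 * dcharCubic Δ a b c x y ε := by
  unfold dcharCubic; rw [dcA_smul, dfsD_smul, dfsN_smul]; ring

/-- **THE VELOCITY-MATCHED SCALE IS HOMOGENEOUS OF DEGREE ONE**: `scaleT(λθ; x, y; λε) = λ·scaleT(θ; x, y; ε)` (`λ ≠ 0`). [folklore] -/
theorem scaleT_smul {l : ℝ} (hl : l ≠ 0) (Δ a b c x y ε : ℝ) :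
    scaleT (l * Δ) (l * a) (l * b) (l * c) x y (l * ε) = l * scaleT Δ a b c x y ε := by
  unfold scaleT
  rw [fsT_smul, dcharCubic_smul]
  by_cases hD : dcharCubic Δ a b c x y ε = 0
  · rw [hD, mul_zero, div_zero, div_zero, mul_zero]
  · have h2 : l ^ 2 ≠ 0 := pow_ne_zero 2 hl
    field_simp

/-- **AT FIXED DOPING THE SCALE SCALES**: `scaleT(λθ; x, y; ε_F(λθ; ν)) = λ·scaleT(θ; x, y; ε_F(θ; ν))` (`λ > 0`; the contour point `(x, y)` is scale free). [folklore] -/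
theorem scaleT_fermiEnergyOf_smul {l : ℝ} (hl : 0 < l) (Δ a b c x y ν : ℝ) :
    scaleT (l * Δ) (l * a) (l * b) (l * c) x y (fermiEnergyOf (l * Δ) (l * a) (l * b) (l * c) ν) =
      l * scaleT Δ a b c x y (fermiEnergyOf Δ a b c ν) := by
  rw [fermiEnergyOf_smul hl, scaleT_smul hl.ne']

/-- **`t_eff/t_pd` AT FIXED DOPING IS A FUNCTION OF THE THREE RATIOS**: for `t_pd > 0`,
`scaleT(Δ, t_pd, t_pp, t_pp′; x, y; ε_F)/t_pd = scaleT(Δ/t_pd, 1, t_pp/t_pd, t_pp′/t_pd; x, y; ε_F)` (each row at its own Fermi energy of filling `ν`). [folklore] -/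
theorem scaleT_fermiEnergyOf_div_tpd_eq_ratios {a : ℝ} (ha : 0 < a) (Δ b c x y ν : ℝ) :
    scaleT Δ a b c x y (fermiEnergyOf Δ a b c ν) / a =
      scaleT (Δ / a) 1 (b / a) (c / a) x y (fermiEnergyOf (Δ / a) 1 (b / a) (c / a) ν) := by
  have h := scaleT_fermiEnergyOf_smul ha (Δ / a) 1 (b / a) (c / a) x y ν
  rw [mul_div_cancel₀ _ ha.ne', mul_one, mul_div_cancel₀ _ ha.ne', mul_div_cancel₀ _ ha.ne'] at h
  rw [h, mul_div_cancel_left₀ _ ha.ne']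

/-- The contour points are scale free: `(x, y)` is on the energy-`λε` contour of the scaled row iff it is on the energy-`ε` contour of the row — in particular the
Fermi-surface points at fixed doping coincide (`λ > 0`). [folklore] -/
theorem charCubic_fermiEnergyOf_smul_eq_zero_iff {l : ℝ} (hl : 0 < l) (Δ a b c x y ν : ℝ) :
    charCubic (l * Δ) (l * a) (l * b) (l * c) x y (fermiEnergyOf (l * Δ) (l * a) (l * b) (l * c) ν) = 0 ↔
      charCubic Δ a b c x y (fermiEnergyOf Δ a b c ν) = 0 := by
  rw [fermiEnergyOf_smul hl, charCubic_smul_eq_zero_iff hl.ne']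

end Summit.Ventures.CertifiedManyBodySolver.Downfold.Emery
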